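import Literature.IUT.HodgeArakelov.AbsTopInterfaces
import Literature.IUT.HodgeArakelov.GaloisPairRigidity
import Literature.IUT.HodgeArakelov.KummerStructures

/-!
# [IUTchII] §1, Example 1.8 (iv): the cyclotomic `(*μ)` and co-cyclotomic `(*×μ)` algorithms ARE functorial (PROOFS)

Mochizuki, *Inter-universal Teichmüller theory II*, §1, Example 1.8 (iv), kurims manuscript (Dec. 2020) p. 38 l. 52 –
p. 39 l. 25 [claim: Mochizuki2012, status: disputed] (IUTchII §1 Ex 1.8 (iv), kurims pp.38-39). Record-only, under the
claim key `Mochizuki2012` (D-0012, disputed). PROOF-ONLY companion (0 `def`) of the INTERFACE file `AbsTopInterfaces.lean`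
(p407495, `AbsTopMonoids.Omu` / `.Oxmu` / `.Mxmu` / `.Ism` / `.toIsm`), of `GaloisPairRigidity.lean` (p409065,
`AbsTopMonoids.actOunits`, `AbsTopMonoids.actOxmu`) and of `KummerStructures.lean` (p403748, the generic algebra
`MulEquivModTorsion` / `actionModTorsion` / `isometryGroup`); abc-iut cell wave W6, node `IUTchII:Ex1.8(iv)`.

Print, (iv): "By considering the subgroups of torsion elements of the various ind-topological monoids that appeared in
(ii) and (iii), one obtains FUNCTORIAL group-theoretic algorithms `Π ↦ (Π ↷ M^μ_TM(Π)); G ↦ (G ↷ O^μ(G))` `(*μ)` …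
Moreover, by forming the quotients `M^{×μ}_TM := M^×_TM/M^μ_TM`, `O^{×μ} := O^×/O^μ`, one obtains FUNCTORIAL
group-theoretic algorithms `Π ↦ (Π ↷ M^{×μ}_TM(Π)); G ↦ (G ↷ O^{×μ}(G))` `(*×μ)` … one verifies easily that by replacing
the symbol `×` in (iii) by `μ` or `×μ` one obtains cyclotomic and co-cyclotomic versions of the example treated in
(iii) … one may replace the `Γ` in (iii) by such a `Γ^{×μ}` [a closed subgroup of `Ism(-)`] … examples: `Ism` itself,
`Im(Ẑ^×)`."

What is PROVED here, over an arbitrary inhabitant `A : AbsTopMonoids S` of the interface (whose `(*⊳)`/`(*TM)` level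
functoriality — `mapOtri`, `mapMTM` with functor laws and equivariance — is interface DATA, [AbsTopIII] §3/§5):
* `(*μ)`: the isomorphism `O^×(G) ⥲ O^×(G*)` induced by `G ⥲ G*`, and every `g ∈ G`, carry `O^μ(G)` ONTO `O^μ(G*)`,
  resp. onto itself (`Omu_map_mapOtri`, `Omu_map_actOunits`); likewise `M^μ_TM` (`torsion_map_mapMTM`, `torsion_map_actMTM`);
* `(*×μ)`: the induced isomorphisms `O^{×μ}(G) ⥲ O^{×μ}(G*)` (= `MulEquivModTorsion (Units.mapEquiv (A.mapOtri f))`)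
  satisfy the FUNCTOR LAWS (`oxmuMap_id`, `oxmuMap_comp`) and are EQUIVARIANT for the `G`-actions along `G ⥲ G*`
  (`oxmuMap_equivariant`); the action `G ↷ O^{×μ}(G)` of p409065 (`actOxmu`, given there one element at a time) IS the
  generic descended action `actionModTorsion (A.actOunits G)` of p403748 (`actOxmu_eq_actionModTorsion`), hence a group
  action (`actOxmu_one`, `actOxmu_mul`); the same on the `Π`-side (`mxmuMap_id`, `mxmuMap_comp`, `mxmuMap_equivariant`);
* `(*TM⊳)` descends: the tautological isomorphism `M_TM(Π) ⥲ O^⊳(Π/Δ)` induces `M^{×μ}_TM(Π) ⥲ O^{×μ}(Π/Δ)`,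
  `Π`-equivariantly (`mxmu_tauto_equivariant`) — the co-cyclotomic comparison `α_{×μ}`'s inducing isomorphism;
* `Ism(G)`: elements of the printed isometry group `isometryGroup (A.actOunits G) 𝓗` (p403748's DEFINITION of "`G`-equivariant
  automorphisms of `O^{×μ}(G)` preserving the lattices `Im(O^×(G)^H)`") commute with `actOxmu` (`isometryGroup_comm_actOxmu`);
* the environments: in the tree's SHAPE model the example of (iii) is `ex18iii S Γ` for an ABSTRACT twisting group `Γ`
  (`RadialExamples`, p406303), so "replacing `Γ` by `Γ^{×μ}`" is an instance; recorded at the two printed examples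
  `Γ^{×μ} = Ism` (the interface group at the reference object) and `Γ^{×μ} = Im(Ẑ^×)` (the range of `toIsm`):
  `ex18iv_ism_isMultiradial`, `ex18iv_imZHat_isMultiradial`.
What is NOT here: a GENUINE `Ism(G)` with `Ẑ^× ↠ ℤ_p^× ↪ Ism(G)` at the [AbsTopIII] model monoids (MERGE-MAP row B9,
holder abc-iut-L6-d2 «B9-ISM-GENUINE»); ind-topologies / compactness of `Ism(G)` (not modelled by the interface).
HONEST FRAMING: elementary algebra over record-only vocabulary under a disputed claim key; nothing here bears on
[IUTchIII] Cor. 3.12; typed ≠ proved ≠ endorsed.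
-/

namespace Literature.IUT.HodgeArakelov

open CategoryTheory

universe u v w

/-! ## Generic: `U ↦ U/U^μ` is functorial in isomorphisms (complements `KummerStructures`, p403748) -/

section Generic

variable {U : Type u} [CommGroup U] {V : Type v} [CommGroup V] {W : Type w} [CommGroup W]

/-- The descent `U/U^μ ⥲ U/U^μ` of the identity is the identity (functor law for `(*×μ)`, identity).
[claim: Mochizuki2012, status: disputed] (IUTchII §1 Ex 1.8 (iv), kurims p.38) -/
theorem mulEquivModTorsion_refl : MulEquivModTorsion (MulEquiv.refl U) = MulEquiv.refl (ModTorsion U) := by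
  apply MulEquiv.ext
  intro x
  induction x using QuotientGroup.induction_on with
  | H z => simp

/-- The descent to `(-)/(-)^μ` of a composite of isomorphisms is the composite of the descents (functor law for
`(*×μ)`, composition). [claim: Mochizuki2012, status: disputed] (IUTchII §1 Ex 1.8 (iv), kurims p.38) -/
theorem mulEquivModTorsion_trans (φ : U ≃* V) (ψ : V ≃* W) :
    MulEquivModTorsion (φ.trans ψ) = (MulEquivModTorsion φ).trans (MulEquivModTorsion ψ) := by
  apply MulEquiv.ext
  intro x
  induction x using QuotientGroup.induction_on with
  | H z => simp

end Generic

variable {S : ThetaSetting.{u}} (A : AbsTopMonoids S)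

namespace AbsTopMonoids

/-! ## `(*μ)`: "the subgroups of torsion elements" are carried onto each other -/

/-- **IUTchII:Ex1.8(iv)** `(*μ)`, `G`-side transport: the isomorphism `O^×(G) ⥲ O^×(G*)` induced by an isomorphism of
topological groups `f : G ⥲ G*` (units of `(*⊳)`'s `mapOtri f`) carries `O^μ(G)` onto `O^μ(G*)`.
[claim: Mochizuki2012, status: disputed] (IUTchII §1 Ex 1.8 (iv), kurims p.38) -/
theorem Omu_map_mapOtri {G H : IsoClass S.Gk} (f : G ⟶ H) :
    (A.Omu G).map (Units.mapEquiv (A.mapOtri f)).toMonoidHom = A.Omu H :=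
  (Units.mapEquiv (A.mapOtri f)).map_torsion

/-- **IUTchII:Ex1.8(iv)** `(*μ)`, `G`-action: every `g ∈ G` carries `O^μ(G)` onto itself, so `G ↷ O^μ(G)`.
[claim: Mochizuki2012, status: disputed] (IUTchII §1 Ex 1.8 (iv), kurims p.38) -/
theorem Omu_map_actOunits (G : IsoClass S.Gk) (g : G.G) :
    (A.Omu G).map (A.actOunits G g).toMonoidHom = A.Omu G :=
  (A.actOunits G g).map_torsion

/-- **IUTchII:Ex1.8(iv)** `(*μ)`, `Π`-side transport: the isomorphism `M^×_TM(Π) ⥲ M^×_TM(Π*)` induced by `Π ⥲ Π*`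
carries `M^μ_TM(Π)` onto `M^μ_TM(Π*)`. [claim: Mochizuki2012, status: disputed] (IUTchII §1 Ex 1.8 (iv), kurims p.38) -/
theorem torsion_map_mapMTM {P Q : IsoClass S.PiX} (f : P ⟶ Q) :
    (CommGroup.torsion (A.MTM P)ˣ).map (Units.mapEquiv (A.mapMTM f)).toMonoidHom = CommGroup.torsion (A.MTM Q)ˣ :=
  (Units.mapEquiv (A.mapMTM f)).map_torsion

/-- **IUTchII:Ex1.8(iv)** `(*μ)`, `Π`-action: every `x ∈ Π` carries `M^μ_TM(Π)` onto itself.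
[claim: Mochizuki2012, status: disputed] (IUTchII §1 Ex 1.8 (iv), kurims p.38) -/
theorem torsion_map_actMTM (P : IsoClass S.PiX) (x : P.G) :
    (CommGroup.torsion (A.MTM P)ˣ).map (Units.mapEquiv (A.actMTM P x)).toMonoidHom = CommGroup.torsion (A.MTM P)ˣ :=
  (Units.mapEquiv (A.actMTM P x)).map_torsion

/-! ## `(*×μ)`: the quotients `O^{×μ} = O^×/O^μ`, `M^{×μ}_TM = M^×_TM/M^μ_TM` are functorial -/

/-- The units of `O^⊳(G)` under the `G`-action: the value of `actOunits` (p409065) on representatives.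
[claim: Mochizuki2012, status: disputed] (IUTchII §1 Ex 1.8 (iii), kurims p.37) -/
theorem coe_actOunits_apply (G : IsoClass S.Gk) (g : G.G) (u : A.Ounits G) :
    ((A.actOunits G g u : A.Ounits G) : A.Otri G) = A.actOtri G g u := rfl

/-- **IUTchII:Ex1.8(iv)** `(*×μ)`: the `G`-action on `O^{×μ}(G)` of p409065 (`actOxmu`, one `g` at a time) IS the generic
descended action `actionModTorsion (A.actOunits G)` of p403748 — the two typings of "`G ↷ O^{×μ}(G)`" agree.
[claim: Mochizuki2012, status: disputed] (IUTchII §1 Ex 1.8 (iv), kurims p.38) -/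
theorem actOxmu_eq_actionModTorsion (G : IsoClass S.Gk) (g : G.G) :
    A.actOxmu G g = (actionModTorsion (A.actOunits G) g).toMonoidHom := by
  apply MonoidHom.ext
  intro x
  induction x using QuotientGroup.induction_on with
  | H z =>
    rw [AbsTopMonoids.actOxmu, QuotientGroup.map_mk]
    simp

/-- **IUTchII:Ex1.8(iv)** `(*×μ)`: on classes, `g · [u] = [g · u]` in `O^{×μ}(G)`.
[claim: Mochizuki2012, status: disputed] (IUTchII §1 Ex 1.8 (iv), kurims p.38) -/
theorem actOxmu_mk (G : IsoClass S.Gk) (g : G.G) (u : A.Ounits G) :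
    A.actOxmu G g (QuotientGroup.mk u) = QuotientGroup.mk (A.actOunits G g u) := by
  rw [AbsTopMonoids.actOxmu, QuotientGroup.map_mk]
  rfl

/-- **IUTchII:Ex1.8(iv)** `(*×μ)`: `G ↷ O^{×μ}(G)` is an action — the identity acts trivially.
[claim: Mochizuki2012, status: disputed] (IUTchII §1 Ex 1.8 (iv), kurims p.38) -/
theorem actOxmu_one (G : IsoClass S.Gk) : A.actOxmu G 1 = MonoidHom.id (A.Oxmu G) := by
  rw [actOxmu_eq_actionModTorsion, map_one]
  rfl

/-- **IUTchII:Ex1.8(iv)** `(*×μ)`: `G ↷ O^{×μ}(G)` is an action — multiplicativity.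
[claim: Mochizuki2012, status: disputed] (IUTchII §1 Ex 1.8 (iv), kurims p.38) -/
theorem actOxmu_mul (G : IsoClass S.Gk) (g h : G.G) :
    A.actOxmu G (g * h) = (A.actOxmu G g).comp (A.actOxmu G h) := by
  rw [actOxmu_eq_actionModTorsion, actOxmu_eq_actionModTorsion, actOxmu_eq_actionModTorsion, map_mul]
  rfl

/-- **IUTchII:Ex1.8(iv)** `(*×μ)`: each `g ∈ G` acts on `O^{×μ}(G)` by a bijection (an automorphism).
[claim: Mochizuki2012, status: disputed] (IUTchII §1 Ex 1.8 (iv), kurims p.38) -/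
theorem actOxmu_bijective (G : IsoClass S.Gk) (g : G.G) : Function.Bijective (A.actOxmu G g) := by
  rw [actOxmu_eq_actionModTorsion]
  exact (actionModTorsion (A.actOunits G) g).bijective

/-- **IUTchII:Ex1.8(iv)** `(*×μ)`, functor law (identity): the isomorphism `O^{×μ}(G) ⥲ O^{×μ}(G)` induced by the identity of
`G` is the identity. [claim: Mochizuki2012, status: disputed] (IUTchII §1 Ex 1.8 (iv), kurims p.38) -/
theorem oxmuMap_id (G : IsoClass S.Gk) :
    MulEquivModTorsion (Units.mapEquiv (A.mapOtri (𝟙 G))) = MulEquiv.refl (A.Oxmu G) := by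
  apply MulEquiv.ext
  intro x
  induction x using QuotientGroup.induction_on with
  | H z =>
    rw [mulEquivModTorsion_mk]
    simp only [MulEquiv.refl_apply]
    congr 1
    ext
    simp [A.mapOtri_id G]

/-- **IUTchII:Ex1.8(iv)** `(*×μ)`, functor law (composition): the isomorphisms `O^{×μ}(G) ⥲ O^{×μ}(G*)` induced by
isomorphisms of topological groups compose. [claim: Mochizuki2012, status: disputed] (IUTchII §1 Ex 1.8 (iv), kurims p.38) -/
theorem oxmuMap_comp {G H K : IsoClass S.Gk} (f : G ⟶ H) (g : H ⟶ K) :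
    MulEquivModTorsion (Units.mapEquiv (A.mapOtri (f ≫ g))) =
      (MulEquivModTorsion (Units.mapEquiv (A.mapOtri f))).trans
        (MulEquivModTorsion (Units.mapEquiv (A.mapOtri g))) := by
  apply MulEquiv.ext
  intro x
  induction x using QuotientGroup.induction_on with
  | H z =>
    simp only [MulEquiv.trans_apply, mulEquivModTorsion_mk]
    congr 1
    ext
    simp [A.mapOtri_comp f g]

/-- **IUTchII:Ex1.8(iv)** `(*×μ)`, equivariance: the induced isomorphism `O^{×μ}(G) ⥲ O^{×μ}(G*)` intertwines the actions
of `G` and `G*` along `f : G ⥲ G*` ("`(G ↷ O^{×μ}(G)) ⥲ (G* ↷ O^{×μ}(G*))` induced by an isomorphism of topological groups").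
[claim: Mochizuki2012, status: disputed] (IUTchII §1 Ex 1.8 (iv), kurims p.38) -/
theorem oxmuMap_equivariant {G H : IsoClass S.Gk} (f : G ⟶ H) (g : G.G) (x : A.Oxmu G) :
    MulEquivModTorsion (Units.mapEquiv (A.mapOtri f)) (A.actOxmu G g x) =
      A.actOxmu H (IsoClass.homIso f g) (MulEquivModTorsion (Units.mapEquiv (A.mapOtri f)) x) := by
  induction x using QuotientGroup.induction_on with
  | H z =>
    rw [actOxmu_mk, mulEquivModTorsion_mk, mulEquivModTorsion_mk, actOxmu_mk]
    congr 1
    ext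
    simp [coe_actOunits_apply, A.mapOtri_equivariant f g]

/-- **IUTchII:Ex1.8(iv)** `(*×μ)`, `Π`-side functor law (identity) for `M^{×μ}_TM`.
[claim: Mochizuki2012, status: disputed] (IUTchII §1 Ex 1.8 (iv), kurims p.38) -/
theorem mxmuMap_id (P : IsoClass S.PiX) :
    MulEquivModTorsion (Units.mapEquiv (A.mapMTM (𝟙 P))) = MulEquiv.refl (A.Mxmu P) := by
  apply MulEquiv.ext
  intro x
  induction x using QuotientGroup.induction_on with
  | H z =>
    rw [mulEquivModTorsion_mk]
    simp only [MulEquiv.refl_apply]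
    congr 1
    ext
    simp [A.mapMTM_id P]

/-- **IUTchII:Ex1.8(iv)** `(*×μ)`, `Π`-side functor law (composition) for `M^{×μ}_TM`.
[claim: Mochizuki2012, status: disputed] (IUTchII §1 Ex 1.8 (iv), kurims p.38) -/
theorem mxmuMap_comp {P Q R : IsoClass S.PiX} (f : P ⟶ Q) (g : Q ⟶ R) :
    MulEquivModTorsion (Units.mapEquiv (A.mapMTM (f ≫ g))) =
      (MulEquivModTorsion (Units.mapEquiv (A.mapMTM f))).trans
        (MulEquivModTorsion (Units.mapEquiv (A.mapMTM g))) := by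
  apply MulEquiv.ext
  intro x
  induction x using QuotientGroup.induction_on with
  | H z =>
    simp only [MulEquiv.trans_apply, mulEquivModTorsion_mk]
    congr 1
    ext
    simp [A.mapMTM_comp f g]

/-- **IUTchII:Ex1.8(iv)** `(*×μ)`, `Π`-side equivariance: the induced `M^{×μ}_TM(Π) ⥲ M^{×μ}_TM(Π*)` intertwines the
`Π`- and `Π*`-actions (descended from `actMTM` through units) along `f : Π ⥲ Π*`.
[claim: Mochizuki2012, status: disputed] (IUTchII §1 Ex 1.8 (iv), kurims p.38) -/
theorem mxmuMap_equivariant {P Q : IsoClass S.PiX} (f : P ⟶ Q) (x : P.G) (m : (A.MTM P)ˣ) :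
    MulEquivModTorsion (Units.mapEquiv (A.mapMTM f))
        (QuotientGroup.mk (Units.mapEquiv (A.actMTM P x) m) : A.Mxmu P) =
      (QuotientGroup.mk (Units.mapEquiv (A.actMTM Q (IsoClass.homIso f x))
        (Units.mapEquiv (A.mapMTM f) m)) : A.Mxmu Q) := by
  rw [mulEquivModTorsion_mk]
  congr 1
  ext
  simp [A.mapMTM_equivariant f x]

/-! ## `(*TM⊳)` descends to `×μ`: the inducing isomorphism of `α_{×μ}` -/

/-- **IUTchII:Ex1.8(iv)** (co-cyclotomic `(*TM⊳)`): the tautological isomorphism `M_TM(Π) ⥲ O^⊳(Π/Δ)` induces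
`M^{×μ}_TM(Π) ⥲ O^{×μ}(Π/Δ)` (`MulEquivModTorsion (Units.mapEquiv (A.tauto P))`), and this isomorphism is `Π`-EQUIVARIANT
for `Π` acting on the right through `Π ↠ Π/Δ` (from `tauto_equivariant`).
[claim: Mochizuki2012, status: disputed] (IUTchII §1 Ex 1.8 (iv), kurims p.38) -/
theorem mxmu_tauto_equivariant (P : IsoClass S.PiX) (x : P.G) (m : (A.MTM P)ˣ) :
    MulEquivModTorsion (Units.mapEquiv (A.tauto P))
        (QuotientGroup.mk (Units.mapEquiv (A.actMTM P x) m) : A.Mxmu P) =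
      A.actOxmu ⟨TopGroup.quot P.G (A.Delta P), A.quotIso P⟩ (QuotientGroup.mk x)
        (MulEquivModTorsion (Units.mapEquiv (A.tauto P)) (QuotientGroup.mk m)) := by
  rw [mulEquivModTorsion_mk, mulEquivModTorsion_mk, actOxmu_mk]
  congr 1
  ext
  change A.tauto P (A.actMTM P x m) = A.actOtri _ (QuotientGroup.mk x) (A.tauto P m)
  exact A.tauto_equivariant P x m

/-! ## `Ism(G)`: isometries commute with the `G`-action -/

/-- **IUTchII:Ex1.8(iv)** `Ism(G)` ("`G`-equivariant automorphisms of `O^{×μ}(G)` that, for each open subgroup `H ⊆ G`,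
preserve the lattice … determined by the image of `O^×(G)^H`", DEFINED generically as `isometryGroup`, p403748): an
isometry `φ ∈ Ism(G) = isometryGroup (A.actOunits G) 𝓗` commutes with the action `actOxmu` of every `g ∈ G` and
preserves every lattice `invariantLattice (A.actOunits G) H`, `H ∈ 𝓗`.
[claim: Mochizuki2012, status: disputed] (IUTchII §1 Ex 1.8 (iv), kurims p.39) -/
theorem isometryGroup_comm_actOxmu (G : IsoClass S.Gk) (𝓗 : Set (Subgroup G.G))
    {φ : MulAut (ModTorsion (A.Ounits G))} (hφ : φ ∈ isometryGroup (A.actOunits G) 𝓗) (g : G.G)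
    (x : A.Oxmu G) : φ (A.actOxmu G g x) = A.actOxmu G g (φ x) := by
  have h := congrArg (fun ψ : MulAut (ModTorsion (A.Ounits G)) => ψ x) (hφ.1 g)
  simpa [actOxmu_eq_actionModTorsion] using h

end AbsTopMonoids

/-! ## The environments of (iv): instances of the shape `ex18iii S Γ^{×μ}` -/

/-- **IUTchII:Ex1.8(iv)** ("in the co-cyclotomic version … one may replace the `Γ` in (iii) by such a `Γ^{×μ}` … one
example of such a `Γ^{×μ}` — which we shall denote by `Ism` — is the case where one takes `Γ^{×μ}` to be the entire group
`Ism(-)`"): in the tree's SHAPE model (`ex18iii S Γ`, twisting group abstract) the co-cyclotomic environment twisted by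
`Ism` — here the interface group `A.Ism` at the reference object `G_k` — is multiradial ("full and essentially surjective").
[claim: Mochizuki2012, status: disputed] (IUTchII §1 Ex 1.8 (iv), kurims p.39) -/
theorem ex18iv_ism_isMultiradial : (ex18iii S (A.Ism (IsoClass.base S.Gk))).IsMultiradial :=
  ex18iii_isMultiradial S _

/-- **IUTchII:Ex1.8(iv)** ("another example of such a `Γ^{×μ}` is the image `Im(Ẑ^×)` of the natural homomorphism
`Ẑ^× ↠ ℤ_p^× ↪ Ism`"): the co-cyclotomic environment twisted by `Im(Ẑ^×)` — the range of the interface map `A.toIsm` at the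
reference object — is multiradial (SHAPE model). [claim: Mochizuki2012, status: disputed] (IUTchII §1 Ex 1.8 (iv), kurims p.39) -/
theorem ex18iv_imZHat_isMultiradial :
    (ex18iii S ↥(A.toIsm (IsoClass.base S.Gk)).range).IsMultiradial :=
  ex18iii_isMultiradial S _

end Literature.IUT.HodgeArakelov
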